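import Literature.NumberTheory.LFunctions.WeilFirstPrimeOddMarginBKappa
import Literature.NumberTheory.LFunctions.WeilFirstPrimeCertificateCCheck
import Literature.NumberTheory.LFunctions.WeilFirstPrimeCertificateCBlock1
import Literature.NumberTheory.LFunctions.WeilFirstPrimeOddMarginBRows0
import Literature.NumberTheory.LFunctions.WeilFirstPrimeOddMarginBRows1
import Literature.NumberTheory.LFunctions.WeilFirstPrimeOddMarginBRows2
import Literature.NumberTheory.LFunctions.WeilFirstPrimeOddMarginBRows3
import Literature.NumberTheory.LFunctions.WeilFirstPrimeOddMarginBRows4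
import Literature.NumberTheory.LFunctions.WeilFirstPrimeOddMarginBRows5
import Literature.NumberTheory.LFunctions.WeilFirstPrimeOddMarginBRows6
import Literature.NumberTheory.LFunctions.WeilFirstPrimeOddMarginBRows7
import Literature.NumberTheory.LFunctions.WeilFirstPrimeOddMarginBRows8
import Literature.NumberTheory.LFunctions.WeilFirstPrimeOddMarginBRows9
import Literature.NumberTheory.LFunctions.WeilFirstPrimeOddMarginBNu0
import Literature.NumberTheory.LFunctions.WeilFirstPrimeOddMarginBNu1
import Literature.NumberTheory.LFunctions.WeilFirstPrimeOddMarginBNu2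
import Literature.NumberTheory.LFunctions.WeilFirstPrimeOddMarginBNu3
import HarnessLib

/-!
# Odd-sector margin certificate B: assembly of the checks

`weilCertOddB` passes the cell check and the moment check (both LITERALLY those of `weilCert3C` up to the rescaling of the table, `…BNu*.lean`), the scalar
side conditions, and its ODD block passes `WeilCert.checkBlockK` at the lowered Bessel coefficient
`κ' = weilCertOddBKappa'` (`D C = I` rows: those of `weilCert3C`, definitionally; dominance rows: the sibling
`…BRows*.lean` files; `WeilCert.checkBlockK_of_rows`). These Booleans are what the odd-margin soundness
theorem consumes. Pure proof file; nothing is asserted.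
-/

noncomputable section

namespace Literature.NumberTheory.LFunctions

/-- **Kernel check of the cells** of certificate B (= the Stage-C cells check, same level, cut-off and cells). [folklore] -/
theorem checkCells_weilCertOddB :
    checkCells₃ weilCertOddB.base.prec weilCertOddB.j weilCertOddB.base.wL weilCertOddB.base.T weilCertOddB.base.mwT weilCertOddB.cells = true :=
  checkCells_weilCert3C

/-- **The moment table of certificate B is correct** (even entries `q ≤ 198`). [folklore] -/
theorem checkNu_weilCertOddB : weilCertOddB.checkNu = true := by
  refine WeilCert2.allBelow_of_forall fun k hk ↦ ?_
  have hk' : k < 100 := hk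
  interval_cases k
  · exact checkNuAt0_weilCertOddB
  · exact checkNuAt2_weilCertOddB
  · exact checkNuAt4_weilCertOddB
  · exact checkNuAt6_weilCertOddB
  · exact checkNuAt8_weilCertOddB
  · exact checkNuAt10_weilCertOddB
  · exact checkNuAt12_weilCertOddB
  · exact checkNuAt14_weilCertOddB
  · exact checkNuAt16_weilCertOddB
  · exact checkNuAt18_weilCertOddB
  · exact checkNuAt20_weilCertOddB
  · exact checkNuAt22_weilCertOddB
  · exact checkNuAt24_weilCertOddB
  · exact checkNuAt26_weilCertOddB
  · exact checkNuAt28_weilCertOddB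
  · exact checkNuAt30_weilCertOddB
  · exact checkNuAt32_weilCertOddB
  · exact checkNuAt34_weilCertOddB
  · exact checkNuAt36_weilCertOddB
  · exact checkNuAt38_weilCertOddB
  · exact checkNuAt40_weilCertOddB
  · exact checkNuAt42_weilCertOddB
  · exact checkNuAt44_weilCertOddB
  · exact checkNuAt46_weilCertOddB
  · exact checkNuAt48_weilCertOddB
  · exact checkNuAt50_weilCertOddB
  · exact checkNuAt52_weilCertOddB
  · exact checkNuAt54_weilCertOddB
  · exact checkNuAt56_weilCertOddB
  · exact checkNuAt58_weilCertOddB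
  · exact checkNuAt60_weilCertOddB
  · exact checkNuAt62_weilCertOddB
  · exact checkNuAt64_weilCertOddB
  · exact checkNuAt66_weilCertOddB
  · exact checkNuAt68_weilCertOddB
  · exact checkNuAt70_weilCertOddB
  · exact checkNuAt72_weilCertOddB
  · exact checkNuAt74_weilCertOddB
  · exact checkNuAt76_weilCertOddB
  · exact checkNuAt78_weilCertOddB
  · exact checkNuAt80_weilCertOddB
  · exact checkNuAt82_weilCertOddB
  · exact checkNuAt84_weilCertOddB
  · exact checkNuAt86_weilCertOddB
  · exact checkNuAt88_weilCertOddB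
  · exact checkNuAt90_weilCertOddB
  · exact checkNuAt92_weilCertOddB
  · exact checkNuAt94_weilCertOddB
  · exact checkNuAt96_weilCertOddB
  · exact checkNuAt98_weilCertOddB
  · exact checkNuAt100_weilCertOddB
  · exact checkNuAt102_weilCertOddB
  · exact checkNuAt104_weilCertOddB
  · exact checkNuAt106_weilCertOddB
  · exact checkNuAt108_weilCertOddB
  · exact checkNuAt110_weilCertOddB
  · exact checkNuAt112_weilCertOddB
  · exact checkNuAt114_weilCertOddB
  · exact checkNuAt116_weilCertOddB
  · exact checkNuAt118_weilCertOddB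
  · exact checkNuAt120_weilCertOddB
  · exact checkNuAt122_weilCertOddB
  · exact checkNuAt124_weilCertOddB
  · exact checkNuAt126_weilCertOddB
  · exact checkNuAt128_weilCertOddB
  · exact checkNuAt130_weilCertOddB
  · exact checkNuAt132_weilCertOddB
  · exact checkNuAt134_weilCertOddB
  · exact checkNuAt136_weilCertOddB
  · exact checkNuAt138_weilCertOddB
  · exact checkNuAt140_weilCertOddB
  · exact checkNuAt142_weilCertOddB
  · exact checkNuAt144_weilCertOddB
  · exact checkNuAt146_weilCertOddB
  · exact checkNuAt148_weilCertOddB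
  · exact checkNuAt150_weilCertOddB
  · exact checkNuAt152_weilCertOddB
  · exact checkNuAt154_weilCertOddB
  · exact checkNuAt156_weilCertOddB
  · exact checkNuAt158_weilCertOddB
  · exact checkNuAt160_weilCertOddB
  · exact checkNuAt162_weilCertOddB
  · exact checkNuAt164_weilCertOddB
  · exact checkNuAt166_weilCertOddB
  · exact checkNuAt168_weilCertOddB
  · exact checkNuAt170_weilCertOddB
  · exact checkNuAt172_weilCertOddB
  · exact checkNuAt174_weilCertOddB
  · exact checkNuAt176_weilCertOddB
  · exact checkNuAt178_weilCertOddB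
  · exact checkNuAt180_weilCertOddB
  · exact checkNuAt182_weilCertOddB
  · exact checkNuAt184_weilCertOddB
  · exact checkNuAt186_weilCertOddB
  · exact checkNuAt188_weilCertOddB
  · exact checkNuAt190_weilCertOddB
  · exact checkNuAt192_weilCertOddB
  · exact checkNuAt194_weilCertOddB
  · exact checkNuAt196_weilCertOddB
  · exact checkNuAt198_weilCertOddB

/-- **The odd block of certificate B passes `checkBlockK` at `κ'`.** [folklore] -/
theorem checkBlock1_weilCertOddB : weilCertOddB.base.checkBlockK weilCertOddB.nuTab weilCertOddBKappa' 1 = true := by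
  refine WeilCert.checkBlockK_of_rows (fun i hi ↦ ?_) (fun i hi ↦ ?_)
  · have hi' : i < 50 := hi
    interval_cases i
    · exact checkDCRow1_0_weilCert3C
    · exact checkDCRow1_1_weilCert3C
    · exact checkDCRow1_2_weilCert3C
    · exact checkDCRow1_3_weilCert3C
    · exact checkDCRow1_4_weilCert3C
    · exact checkDCRow1_5_weilCert3C
    · exact checkDCRow1_6_weilCert3C
    · exact checkDCRow1_7_weilCert3C
    · exact checkDCRow1_8_weilCert3C
    · exact checkDCRow1_9_weilCert3C
    · exact checkDCRow1_10_weilCert3C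
    · exact checkDCRow1_11_weilCert3C
    · exact checkDCRow1_12_weilCert3C
    · exact checkDCRow1_13_weilCert3C
    · exact checkDCRow1_14_weilCert3C
    · exact checkDCRow1_15_weilCert3C
    · exact checkDCRow1_16_weilCert3C
    · exact checkDCRow1_17_weilCert3C
    · exact checkDCRow1_18_weilCert3C
    · exact checkDCRow1_19_weilCert3C
    · exact checkDCRow1_20_weilCert3C
    · exact checkDCRow1_21_weilCert3C
    · exact checkDCRow1_22_weilCert3C
    · exact checkDCRow1_23_weilCert3C
    · exact checkDCRow1_24_weilCert3C
    · exact checkDCRow1_25_weilCert3C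
    · exact checkDCRow1_26_weilCert3C
    · exact checkDCRow1_27_weilCert3C
    · exact checkDCRow1_28_weilCert3C
    · exact checkDCRow1_29_weilCert3C
    · exact checkDCRow1_30_weilCert3C
    · exact checkDCRow1_31_weilCert3C
    · exact checkDCRow1_32_weilCert3C
    · exact checkDCRow1_33_weilCert3C
    · exact checkDCRow1_34_weilCert3C
    · exact checkDCRow1_35_weilCert3C
    · exact checkDCRow1_36_weilCert3C
    · exact checkDCRow1_37_weilCert3C
    · exact checkDCRow1_38_weilCert3C
    · exact checkDCRow1_39_weilCert3C
    · exact checkDCRow1_40_weilCert3C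
    · exact checkDCRow1_41_weilCert3C
    · exact checkDCRow1_42_weilCert3C
    · exact checkDCRow1_43_weilCert3C
    · exact checkDCRow1_44_weilCert3C
    · exact checkDCRow1_45_weilCert3C
    · exact checkDCRow1_46_weilCert3C
    · exact checkDCRow1_47_weilCert3C
    · exact checkDCRow1_48_weilCert3C
    · exact checkDCRow1_49_weilCert3C
  · have hi' : i < 50 := hi
    interval_cases i
    · exact checkDomRow1_0_weilCertOddB
    · exact checkDomRow1_1_weilCertOddB
    · exact checkDomRow1_2_weilCertOddB
    · exact checkDomRow1_3_weilCertOddB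
    · exact checkDomRow1_4_weilCertOddB
    · exact checkDomRow1_5_weilCertOddB
    · exact checkDomRow1_6_weilCertOddB
    · exact checkDomRow1_7_weilCertOddB
    · exact checkDomRow1_8_weilCertOddB
    · exact checkDomRow1_9_weilCertOddB
    · exact checkDomRow1_10_weilCertOddB
    · exact checkDomRow1_11_weilCertOddB
    · exact checkDomRow1_12_weilCertOddB
    · exact checkDomRow1_13_weilCertOddB
    · exact checkDomRow1_14_weilCertOddB
    · exact checkDomRow1_15_weilCertOddB
    · exact checkDomRow1_16_weilCertOddB
    · exact checkDomRow1_17_weilCertOddB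
    · exact checkDomRow1_18_weilCertOddB
    · exact checkDomRow1_19_weilCertOddB
    · exact checkDomRow1_20_weilCertOddB
    · exact checkDomRow1_21_weilCertOddB
    · exact checkDomRow1_22_weilCertOddB
    · exact checkDomRow1_23_weilCertOddB
    · exact checkDomRow1_24_weilCertOddB
    · exact checkDomRow1_25_weilCertOddB
    · exact checkDomRow1_26_weilCertOddB
    · exact checkDomRow1_27_weilCertOddB
    · exact checkDomRow1_28_weilCertOddB
    · exact checkDomRow1_29_weilCertOddB
    · exact checkDomRow1_30_weilCertOddB
    · exact checkDomRow1_31_weilCertOddB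
    · exact checkDomRow1_32_weilCertOddB
    · exact checkDomRow1_33_weilCertOddB
    · exact checkDomRow1_34_weilCertOddB
    · exact checkDomRow1_35_weilCertOddB
    · exact checkDomRow1_36_weilCertOddB
    · exact checkDomRow1_37_weilCertOddB
    · exact checkDomRow1_38_weilCertOddB
    · exact checkDomRow1_39_weilCertOddB
    · exact checkDomRow1_40_weilCertOddB
    · exact checkDomRow1_41_weilCertOddB
    · exact checkDomRow1_42_weilCertOddB
    · exact checkDomRow1_43_weilCertOddB
    · exact checkDomRow1_44_weilCertOddB
    · exact checkDomRow1_45_weilCertOddB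
    · exact checkDomRow1_46_weilCertOddB
    · exact checkDomRow1_47_weilCertOddB
    · exact checkDomRow1_48_weilCertOddB
    · exact checkDomRow1_49_weilCertOddB

end Literature.NumberTheory.LFunctions
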